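import Summits.NavierStokesRegularity.NavierStokesRegularity.Theses.AxisymmetricExtremality
import Summits.NavierStokesRegularity.NavierStokesRegularity.Theorems.AxisymmetricExtremalityAxisymmetricKatoGlobalStubKatoAxisymSingularPoint
import Summits.NavierStokesRegularity.NavierStokesRegularity.Theorems.AxisymmetricExtremalityAxisymmetricKatoGlobalStubKatoLocalEnergyNearTop
import Summits.NavierStokesRegularity.NavierStokesRegularity.Theorems.AxisymmetricExtremalityAxisymmetricKatoGlobalReduction
import Summits.NavierStokesRegularity.NavierStokesRegularity.Theorems.AxisymmetricExtremalityAxisymmetricKatoGlobalStubOffAxisBoundedOfLocalEnergy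
import Summits.NavierStokesRegularity.NavierStokesRegularity.Theorems.AxisymmetricExtremalityAxisymmetricKatoGlobalStubAxisBoundedOfLocalEnergyOrigin
import Summits.NavierStokesRegularity.NavierStokesRegularity.Theorems.AxisymmetricExtremalityAxisymmetricKatoGlobalStubTypeIITransfer
import Literature.Analysis.FluidPDE.SereginSverakAxisymmetric
import Literature.Analysis.FluidPDE.RusinSverakSingularPoint
import Literature.Analysis.FluidPDE.AxisymmetricTypeIBounded
import Literature.Analysis.FluidPDE.Seregin2020AxisymmetricTypeII
import HarnessLib.Audit

/-!
# Line `euler-scaling` — crux `AxisymmetricExtremality.AxisymmetricKatoGlobal`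
# (stmt-NavierStokesRegularity-15453): Type II exclusion at the axis, cut by GROWTH ORDER

Strategist line (planner-cstrat-stmt-NavierStokesRegularity-15453-b1-0, 2026-08-17), registered
ALONGSIDE the lead's line `registered` (swirl log³-modulus).  It does not touch that line; it
consumes its LANDED stubs 1 (`stub_katoAxisymSingularPoint`, p149337), K (`stub_katoLocalEnergyNearTop`,
p149176) and 2b' (`stub_offAxisBounded_of_localEnergy`, p147674) by name.

THE CUT.  Blow-up of an axisymmetric Kato solution ⇒ a singular point `(T, x_*)` (stub 1); off the
axis it is impossible (landed 2b'); ON the axis it is a TYPE II point in Seregin's sense — every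
scaled energy, in particular the scaled cubic quantity `C(r) = r⁻² ∫_{Q_r} |u|³`, has infinite
upper limit (Seregin 2020, Thm 2.1 = tree named fact `Seregin2020_axisymmetricSingularPoint_typeII`,
stub 2, transferred to viscosity `ν`, final time `T` and an arbitrary axis point in stub 3).  So the
crux is EXACTLY "a priori, `limsup_{r→0} C(r) < ∞` at axis points" (Type II exclusion), and this
line cuts that a-priori statement by the GROWTH ORDER of `C(r)`:

* stub 4 `stub_subpowerTypeII_excluded` — if `C(r) ≤ r^{-δ}` near `0` for EVERY `δ > 0`
  (sub-power growth), then `limsup C(r) < ∞` (the "slightly supercritical" regime: Navier–Stokes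
  scaling, quantitative / log-supercritical criteria; Seregin 2022 (Giga volume), Pan 2016,
  Lei–Zhang 2017, Barker–Prange 2021; OPEN as a power-gap statement);
* stub 5 `stub_powerTypeII_excluded` — `C(r_k) ≥ r_k^{-δ}` along `r_k → 0` for some `δ > 0`
  (power-type Type II) is impossible.  THIS is where the new lever bites: under power-type
  concentration the EULER SCALING `u ↦ λ^α u(λ y, λ^{1+α} s)`, `α = 2 - m > 1`, has a non-trivial
  ancient limit solving EULER (viscosity scales out as `λ^{α-1}`), and because the swirl
  `Γ = r u_θ` is bounded (maximum principle) and scale-invariant, `Γ_λ = λ^{α-1} Γ ∘ (λ·) → 0`: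
  the limit is a SWIRL-FREE axisymmetric ancient Euler flow whose `ω_θ/r` is transported, with
  conserved `∫ Φ(|ω_θ/r|)` (Seregin, arXiv:2402.13229, Prop. 1.1, Lemma 2.1, Props 2.2–2.3, 3.1, 4.1;
  Seregin, CPAA 23 (2024) 1389–1406).  What remains of stub 5 after Seregin: order matching
  (a single Euler order with two-sided bounds) and the Liouville theorem for such swirl-free
  ancient Euler flows without the extra `L_q` hypothesis of Prop. 2.3.  OPEN, with partial print.

The swirl enters ONLY through its boundedness (never through a modulus of continuity at the
axis — the stuck stub 3 of line `registered`); the algebraic identity behind "Euler scaling kills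
the swirl" is the closed support lemma `swirl_smul_comp_smul` below.

`AxisymmetricKatoGlobal_of` (the ONLY crux-concluding theorem; crux BY NAME; no `Prop`
hypotheses; placeholders only inside the four `stub_*` of this line) is the real composition: by
contradiction, singular point (landed stub 1), pressure + local energy classes to the top (landed K),
off-axis case (landed 2b'), axis case: ¬(power growth) (stub 5) ⇒ sub-power growth ⇒
`limsup C < ∞` (stub 4) ⇒ bounded near `(T, x_*)` (stubs 2 + 3) — contradicting the singular
cylinder (`eLpNorm_parabolicCylinder_lt_top_of_bound`).

UNION REGISTRATION (tooling note).  `ledger skeleton check` keeps exactly ONE registered skeleton per crux: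
registering this file deactivated the two open stubs of the lead's line (`stub_sereginLogSwirlOrigin`,
`stub_swirlAxisModulus`, "not in skeleton").  To keep BOTH lines' stubs registered this file therefore
also carries those two stubs VERBATIM (the lead's signatures of skeleton 8c9cba40) together with the
lead's LANDED capstone `Registered.AxisymmetricKatoGlobal_of_logSwirlFacts` (p150628) applied to them
(`AxisymmetricKatoGlobal_of_swirlLine`); the
strategist's own line is `AxisymmetricKatoGlobal_of`.  Nothing of the lead's files is touched.

Disproof used: none exists for this crux (`ledger crux ls`, 2026-08-17: no `Disproof.lean`, no
dead lines, no crux ideas); negatives index (4 entries) — no stub is an instance.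
-/

noncomputable section

open Set MeasureTheory Filter Topology Function Metric
open scoped ENNReal NNReal
open Literature.Analysis.FluidPDE Literature.Analysis.FunctionSpaces
open Summit.NavierStokesRegularity.NavierStokesRegularity.Theorems.AxisymmetricKatoGlobal

namespace Summit.NavierStokesRegularity.NavierStokesRegularity.Cruxes.AxisymmetricKatoGlobal.EulerScaling

set_option linter.unusedVariables false
set_option linter.dupNamespace false

local notation "ℝ³" => EuclideanSpace ℝ (Fin 3)

/-- **stub 2 — `stub_seregin2020TypeII` (LITERATURE FACT, XL to discharge, printed theorem):**
Seregin, Anal. Math. Phys. 10 (2020) Paper 46 = arXiv:2006.04140, Thm 2.1 — an axially symmetric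
suitable weak solution in the unit cylinder whose origin is a singular point has blow-up index
`g(0) = ∞` (all of `limsup E, limsup A, limsup C` infinite): "axisymmetric solutions have no
Type I blow-ups".  Verbatim the tree's named fact; closes by its `_holds` once discharged. -/
theorem stub_seregin2020TypeII : Seregin2020_axisymmetricSingularPoint_typeII := by
  sorry

/-! **stub 3 — `stub_typeII_transfer` — LANDED** (lead c2, wave 1: p153998,
`Theorems/AxisymmetricExtremalityAxisymmetricKatoGlobalStubTypeIITransfer.lean`, theorem
`Theorems.AxisymmetricKatoGlobal.EulerScaling.stub_typeII_transfer` with reusable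
`cknC_zero_rescale_le`, `limsup_cknC_zero_rescale_lt_top`); used BY NAME in the composition below,
no longer a stub of this file. -/

/-- **stub 4 — `stub_subpowerTypeII_excluded` (XL; OPEN — the Navier–Stokes-scaling half).**
For an axisymmetric Kato solution on `[0, T)` from a datum represented in `Ḣ^{1/2}`, smooth on
`(0,T) × ℝ³`, and an axis point `x₀`: if the scaled cubic quantity grows slower than every power,
`C(r) ≤ r^{-δ}` for `0 < r < r₀(δ)` and every `δ > 0`, then it is in fact bounded,
`limsup_{r→0} C(r) < ∞`.  A power-gap strengthening of the slightly supercritical criteria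
(Seregin 2022 (Giga volume); Pan, JDE 2016; Lei–Zhang 2017 / Wei 2016 log-moduli; Barker–Prange
2021).  Why it might fail: a nearly self-similar axisymmetric blow-up with logarithmic
corrections (Hou, arXiv:2107.06509) would have unbounded sub-power `C(r)`. -/
theorem stub_subpowerTypeII_excluded :
    ∀ ν : ℝ, 0 < ν → ∀ T : ℝ, 0 < T → ∀ (u₀ : ℝ³ → ℝ³)
      (g : HomSobolev ℝ³ (EuclideanSpace ℂ (Fin 3)) (1 / 2 : ℝ)) (u : ℝ → ℝ³ → ℝ³),
      g.Represents (Literature.Analysis.FunctionSpaces.EuclideanSpace.complexify ∘ u₀) →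
      IsKatoSolutionOn T ν u₀ u → ContDiffOn ℝ (⊤ : ℕ∞) (uncurry u) (Ioo 0 T ×ˢ univ) →
      (∀ t ∈ Ioo 0 T, IsAxisymmetric (u t)) →
      ∀ x₀ : ℝ³, cylRadius x₀ = 0 →
        (∀ δ : ℝ, 0 < δ → ∃ r₀ : ℝ, 0 < r₀ ∧ ∀ r ∈ Ioo 0 r₀,
            cknC r ((T, x₀) : ℝ × ℝ³) u ≤ ENNReal.ofReal (r ^ (-δ))) →
        limsup (fun r => cknC r ((T, x₀) : ℝ × ℝ³) u) (𝓝[>] 0) < ∞ := by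
  sorry

/-- **stub 5 — `stub_powerTypeII_excluded` (XL; OPEN with partial print — the Euler-scaling
half, the load-bearing bet of this line).**  In the same setting, power-type concentration of the
scaled cubic quantity at an axis point never happens: there are no `δ > 0` and `r_k → 0` with
`C(r_k) ≥ r_k^{-δ}`.  Attack (Seregin, CPAA 23 (2024) 1389–1406; arXiv:2402.13229): select an
Euler order `m ∈ [1/2, 1)` with two-sided scaled bounds; the Euler scaling
`λ^α u(λy, λ^{1+α}s)`, `α = 2 - m`, converges to a non-trivial ancient suitable EULER flow which is
axisymmetric WITHOUT swirl (`swirl_smul_comp_smul`: the bounded scale-invariant swirl is damped by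
`λ^{α-1}`); its `ω_θ/r` is transported and `∫ Φ(|ω_θ/r|)` is conserved (Prop. 2.2); a Liouville
theorem for that class (known under `sup_t ‖u‖_{L_q}`, `q = 3/(2-m)`, Prop. 2.3; self-similar and
discretely self-similar profiles excluded, Props 3.1, 4.1) gives the contradiction.  Why it might
fail: orders may oscillate between scales (no single matched order), and the unconditional
Liouville theorem for swirl-free ancient Euler flows with these scaled bounds is open. -/
theorem stub_powerTypeII_excluded :
    ∀ ν : ℝ, 0 < ν → ∀ T : ℝ, 0 < T → ∀ (u₀ : ℝ³ → ℝ³)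
      (g : HomSobolev ℝ³ (EuclideanSpace ℂ (Fin 3)) (1 / 2 : ℝ)) (u : ℝ → ℝ³ → ℝ³),
      g.Represents (Literature.Analysis.FunctionSpaces.EuclideanSpace.complexify ∘ u₀) →
      IsKatoSolutionOn T ν u₀ u → ContDiffOn ℝ (⊤ : ℕ∞) (uncurry u) (Ioo 0 T ×ˢ univ) →
      (∀ t ∈ Ioo 0 T, IsAxisymmetric (u t)) →
      ∀ x₀ : ℝ³, cylRadius x₀ = 0 →
        ¬ ∃ δ : ℝ, 0 < δ ∧ ∀ r₀ : ℝ, 0 < r₀ → ∃ r ∈ Ioo 0 r₀,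
            ENNReal.ofReal (r ^ (-δ)) ≤ cknC r ((T, x₀) : ℝ × ℝ³) u := by
  sorry

/-! ### Stubs of the lead's line `registered` (carried verbatim so that they stay registered) -/

/-- **lead stub 2a — `stub_sereginLogSwirlOrigin` (line `registered`, lead c1; LITERATURE FACT
`seregin2022_logSwirl_regularAtOrigin`, Seregin, J. Math. Fluid Mech. 24 (2022) = arXiv:2201.00153,
§2).** Carried verbatim from the lead's skeleton 8c9cba40; not part of line `euler-scaling`. -/
theorem stub_sereginLogSwirlOrigin :
    ∀ (v : ℝ → ℝ³ → ℝ³) (q : ℝ → ℝ³ → ℝ),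
      IsSuitableWeakSolutionOn (SereginSverak2009.parCylOpens 0 1) 1 0 v q →
      (∃ C : ℝ≥0, ∀ᵐ t ∂(volume.restrict (Ioo (-1 : ℝ) 0)),
          ∫⁻ x in SereginSverak2009.spaceCyl 0 1, ‖v t x‖ₑ ^ 2 ≤ C) →
      (∃ G : ℝ → ℝ³ → ℝ³ →L[ℝ] ℝ³,
          HasWeakSpatialGradientOn (SereginSverak2009.parCylOpens 0 1) v G ∧
          ∫⁻ z in SereginSverak2009.parCyl 0 1, ENNReal.ofReal (frobeniusNormSq (G z.1 z.2)) < ∞) →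
      (∫⁻ z in SereginSverak2009.parCyl 0 1, ‖q z.1 z.2‖ₑ ^ (3 / 2 : ℝ) < ∞) →
      (∀ t ∈ Ioo (-1 : ℝ) 0, IsAxisymmetric (v t)) →
      (∀ t ∈ Ioo (-1 : ℝ) 0, IsAxisymmetricScalar (q t)) →
      (∃ C₁ : ℝ, ∀ t ∈ Ioo (-1 : ℝ) 0, ∀ x ∈ SereginSverak2009.spaceCyl 0 1, 0 < cylRadius x →
          |swirl (v t) x| ≤ C₁ / Real.log (Real.exp 1 / cylRadius x) ^ 3) →
      SereginSverak2009.IsRegularAtOrigin v := by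
  sorry

/-- **lead stub 3 — `stub_swirlAxisModulus` (line `registered`, lead c1; its open bet: the
log³ axis modulus of the swirl up to the final time).** Carried verbatim from the lead's skeleton
8c9cba40; not part of line `euler-scaling`. -/
theorem stub_swirlAxisModulus :
    ∀ ν : ℝ, 0 < ν → ∀ T : ℝ, 0 < T → ∀ (u₀ : ℝ³ → ℝ³)
      (g : HomSobolev ℝ³ (EuclideanSpace ℂ (Fin 3)) (1 / 2 : ℝ)) (u : ℝ → ℝ³ → ℝ³),
      g.Represents (Literature.Analysis.FunctionSpaces.EuclideanSpace.complexify ∘ u₀) →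
      IsKatoSolutionOn T ν u₀ u → ContDiffOn ℝ (⊤ : ℕ∞) (uncurry u) (Ioo 0 T ×ˢ univ) →
      (∀ t ∈ Ioo 0 T, IsAxisymmetric (u t)) →
      ∀ t₀ ∈ Ioo 0 T, ∃ C δ₀ : ℝ, 0 < δ₀ ∧ δ₀ < 1 ∧
        ∀ t ∈ Ico t₀ T, ∀ x : ℝ³, cylRadius x ≤ δ₀ →
          |swirl (u t) x| ≤ C / |Real.log (cylRadius x)| ^ 3 := by
  sorry

/-! ### Closed support lemmas -/

/-- **Euler scaling damps the swirl** (the algebraic identity behind stub 5): for the rescaled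
field `v(y) = c • u(l • y)` one has `Γ_v(y) = (c / l) · Γ_u(l • y)`; with `c = λ^α`, `l = λ`,
`α > 1`, a bounded swirl `|Γ_u| ≤ M` gives `|Γ_v| ≤ λ^{α-1} M → 0` (Seregin, arXiv:2402.13229, §2,
first display). [cite: arXiv:2402.13229, §2] -/
theorem swirl_smul_comp_smul (u : ℝ³ → ℝ³) (c l : ℝ) (hl : l ≠ 0) (y : ℝ³) :
    swirl (fun x => c • u (l • x)) y = c / l * swirl u (l • y) := by
  simp only [swirl, PiLp.smul_apply, smul_eq_mul]
  field_simp

/-- A pointwise bound on the backward cylinder `(T − r², T) × B_r(x_*)` makes the `L^∞` norm of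
`uncurry u` on `parabolicCylinder r (T, x_*)` finite (support lemma of the composition; same as in
line `registered`). [folklore] -/
theorem eLpNorm_parabolicCylinder_lt_top_of_bound {u : ℝ → ℝ³ → ℝ³} {T r K : ℝ} {xs : ℝ³}
    (h : ∀ t ∈ Ioo (T - r ^ 2) T, ∀ x ∈ ball xs r, ‖u t x‖ ≤ K) :
    eLpNorm (uncurry u) ∞ (volume.restrict (parabolicCylinder r (T, xs))) < ∞ := by
  have hmeas : MeasurableSet (parabolicCylinder r ((T, xs) : ℝ × ℝ³)) := by
    unfold parabolicCylinder
    exact measurableSet_Ioo.prod measurableSet_ball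
  have hbound : ∀ᵐ z ∂(volume.restrict (parabolicCylinder r ((T, xs) : ℝ × ℝ³))), ‖uncurry u z‖ ≤ K := by
    filter_upwards [ae_restrict_mem hmeas] with z hz
    obtain ⟨ht, hx⟩ := mem_prod.1 hz
    exact h z.1 ht z.2 hx
  rw [eLpNorm_exponent_top]
  exact (eLpNormEssSup_le_of_ae_bound hbound).trans_lt ENNReal.ofReal_lt_top

/-- Pure logic of the order dichotomy: not power-type ⇒ sub-power growth. [folklore] -/
theorem subpower_of_not_power {C : ℝ → ℝ≥0∞}
    (h : ¬ ∃ δ : ℝ, 0 < δ ∧ ∀ r₀ : ℝ, 0 < r₀ → ∃ r ∈ Ioo 0 r₀, ENNReal.ofReal (r ^ (-δ)) ≤ C r) :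
    ∀ δ : ℝ, 0 < δ → ∃ r₀ : ℝ, 0 < r₀ ∧ ∀ r ∈ Ioo 0 r₀, C r ≤ ENNReal.ofReal (r ^ (-δ)) := by
  intro δ hδ
  by_contra hc
  push Not at hc
  exact h ⟨δ, hδ, fun r₀ hr₀ => by
    obtain ⟨r, hr, hlt⟩ := hc r₀ hr₀
    exact ⟨r, hr, le_of_lt hlt⟩⟩

/-- **Composition (the skeleton theorem).** The crux BY NAME from the three registered stubs
2, 4, 5 (used by name) and the four LANDED stubs 1, K, 2b' (line `registered`, lead c1:
`Registered.stub_katoAxisymSingularPoint`, `Registered.stub_katoLocalEnergyNearTop`,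
`Registered.stub_offAxisBounded_of_localEnergy`) and 3 (lead c2: `EulerScaling.stub_typeII_transfer`):
by contradiction. -/
theorem AxisymmetricKatoGlobal_of : Theses.AxisymmetricExtremality.AxisymmetricKatoGlobal := by
  have h1 := Registered.stub_katoAxisymSingularPoint
  have h2 := stub_seregin2020TypeII
  have h3 := Theorems.AxisymmetricKatoGlobal.EulerScaling.stub_typeII_transfer
  have h4 := stub_subpowerTypeII_excluded
  have h5 := stub_powerTypeII_excluded
  intro ν hν u₀ g hL3 hrep hdiv hax
  -- the written-out rotation-equivariance of the crux is `IsAxisymmetric u₀` definitionally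
  have hax' : IsAxisymmetric u₀ := fun θ x => hax θ x
  by_contra hng
  -- stub 1: a finite-time Kato solution, smooth and axisymmetric inside, singular at `(T, xs)`
  obtain ⟨T, hT, xs, u, hK, hsm, haxi, hsing⟩ := h1 ν hν u₀ hL3 hdiv hax' hng
  -- landed K: an axisymmetric pressure, suitability on the strip, local energy classes to the top
  obtain ⟨p, hpax, hsw, hloc⟩ := Registered.stub_katoLocalEnergyNearTop ν hν T hT u₀ u hK hsm haxi
  -- every point, in particular `xs`, is bounded near the final time
  have hbdd : IsBoundedNearTop u T xs := by
    by_cases h0 : cylRadius xs = 0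
    · -- on the axis: Type II is excluded a priori (stubs 4 + 5), so Seregin 2020 (stubs 2 + 3) applies
      have hsub := subpower_of_not_power (h5 ν hν T hT u₀ g u hrep hK hsm haxi xs h0)
      have hC : limsup (fun r => cknC r ((T, xs) : ℝ × ℝ³) u) (𝓝[>] 0) < ∞ :=
        h4 ν hν T hT u₀ g u hrep hK hsm haxi xs h0 hsub
      exact h3 h2 ν hν T hT u p hsm haxi hpax hsw hloc xs h0 hC
    · -- off the axis: landed stub 2b'
      exact Registered.stub_offAxisBounded_of_localEnergy ν hν T hT u p hsm haxi hsw hloc xs h0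
  obtain ⟨r, hr, K, hbd⟩ := hbdd
  -- contradiction with the singularity of `(T, xs)` at radius `r`
  exact absurd (hsing r hr) (eLpNorm_parabolicCylinder_lt_top_of_bound hbd).ne

/-- **The lead's line (union registration).** The crux from the lead's two open stubs 2a, 3 via the
lead's LANDED capstone `Registered.AxisymmetricKatoGlobal_of_logSwirlFacts` (p150628). -/
theorem AxisymmetricKatoGlobal_of_swirlLine : Theses.AxisymmetricExtremality.AxisymmetricKatoGlobal :=
  Registered.AxisymmetricKatoGlobal_of_logSwirlFacts stub_sereginLogSwirlOrigin stub_swirlAxisModulus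

end Summit.NavierStokesRegularity.NavierStokesRegularity.Cruxes.AxisymmetricKatoGlobal.EulerScaling
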